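import Literature.Barriers.HubbardSuperconductivity.FiniteFieldResponseWithoutLRO
import Mathlib.Analysis.SpecialFunctions.Sqrt
import Mathlib.Analysis.Calculus.LocalExtr.Basic
import Mathlib.Analysis.Calculus.Deriv.Pow
import Mathlib.Analysis.Calculus.Deriv.Mul
import HarnessLib

/-!
# The sourced gapped paramagnet, solved exactly: ground energy `−(N/2)√(B²+h²)`, response `N h/(2√(B²+h²))`,
# `m* = 0`

Topic `Literature/MathematicalPhysics/QuantumLattice`; object = the gapped paramagnet of
`Literature/Barriers/HubbardSuperconductivity/FiniteFieldResponseWithoutLRO.lean` (`GappedParamagnet.paramagnet N B`,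
a Koma–Tasaki `U(1)` system on `N` spins `½`: `H_N = B Σ_x S^z_x`, order operator `O = O^{(1)} = Σ_x S^x_x`, sourced
("pinned") Hamiltonian `K_h = H_N − h O = GappedParamagnet.sourced N B h`).  That file proved only the bounds its
barrier needed (response floor `(N/2)(1 − B/h)`, ceiling `2hN/B`) and recorded the exact values as un-formalised
folklore; the cell `hubbard-cq` (summit `HubbardSuperconductivity`) now uses the EXACT near-critical profile of this
object as a calibration / kill-test standard for finite-field order-parameter rules (KILL-KIT W9; barrier
`SqrtFieldExtrapolationFalsePositive`, which imports this file).  Everything below holds at EVERY volume `N` with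
no `N`-dependence of the densities, so thermodynamic limits are identities.

## Content (all `B > 0` unless stated, every `h ∈ ℝ`, every `N`)

* §1 `re_inner_sourced_ge_sqrt`: the SHARP operator inequality `K_h ≥ −(N/2)√(B² + h²)` (any real `B, h`) — site by
  site, `k_x = B S^z_x − h S^x_x` (`siteOp`) is symmetric with `k_x² = ¼(B² + h²)·1` (`siteOp_siteOp_apply`), so
  `|⟨ψ, k_xψ⟩| ≤ ‖ψ‖‖k_xψ‖ = ½√(B² + h²)‖ψ‖²` (Cauchy–Schwarz).
* §2 product states `ψ_w(σ) = Π_x w(σ_x)` (`productVec`, real amplitudes): `‖ψ_w‖² = (Σ_b w_b²)^N`, one-site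
  diagonal / flip expectations (`inner_productVec_diagOp`, `inner_productVec_flipOp`, via `Fintype.prod_sum`); the
  tilted product state `⊗_x ((√(B²+h²) + B)|↓⟩ + h|↑⟩)` (`tilt`) saturates the bound:
  `Re⟨ψ, K_hψ⟩ = −(N/2)√(B² + h²)‖ψ‖²` (`re_inner_sourced_tilt`).
* §3 `gs_energy_eq`: EVERY variational ground state `Φ` of `K_h` (`GappedParamagnet.IsVariationalGS`) has
  `Re⟨Φ, K_hΦ⟩ = −(N/2)√(B² + h²)`; `gs_response_eq`: and `Re⟨Φ, OΦ⟩ = N h/(2√(B² + h²))` — Hellmann–Feynman WITHOUT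
  perturbation theory or uniqueness: `h' ↦ (N/2)√(B² + h'²) − (h' − h)·Re⟨Φ, OΦ⟩` has a global minimum at `h' = h` by
  the variational principle against the exact energies, so its derivative vanishes there (Fermat,
  `IsLocalMin.hasDerivAt_eq_zero`).
* §4 the closed forms as functions of the field: `energyDensity B h = −½√(B² + h²)` (energy per site),
  `response B h = h/(2√(B² + h²))` (Koma–Tasaki's sourced order parameter `m(h)` per site, before `h ↓ 0`),
  `chord B a b = (e(a) − e(b))/(b − a)`; model links `gs_energy_eq_mul_energyDensity`,
  `gs_response_eq_mul_response`; `m* = 0`: `response_le` (`m ≤ h/(2B)`), `tendsto_response_zero`; `response_lt_half`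
  (never saturated), `response_ge` (`m(a) ≥ ½(1 − B/a)`).
* §5 the chord sandwich `m(a) ≤ S(a, b) ≤ m(b)` for `0 ≤ a < b` (`response_le_chord`, `chord_le_response`; closed
  form `chord_eq`: `S(a,b) = (a + b)/(2(√(B²+a²) + √(B²+b²)))`) — the certified bracket of the cell's pinning-field
  line, here exact.

Not here: uniqueness of the sourced ground state (true — `K_h` is unitarily a paramagnet in the field `√(B²+h²)` —
but not needed: energy and response are pinned in EVERY ground state); the symmetric-floor facts (unique gapped
ground state, no LRO), which are `GappedParamagnet.paramagnet_profile`.  No named fact, no `sorry`; helper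
identities are `private`/[folklore].

References: T. Koma, H. Tasaki, J. Stat. Phys. 76 (1994) 745, arXiv:cond-mat/9708132, §1.2 (the transverse-field
example: order operator, symmetry-breaking field, `m(B) := lim_{B'↓0} lim_N N⁻¹⟨O⟩`, `m(B) = 0` for large field) and
§2.5 (one-sidedness) [KomaTasaki1994]; H. Tasaki, *Physics and Mathematics of Quantum Many-Body Systems* (Springer
2020), §2.1 (a single quantum spin; spins in a magnetic field; variational characterisation of ground states (2.1.6))
[Tasaki2020]; R. B. Griffiths, J. Math. Phys. 5 (1964) 1215 / Phys. Rev. 152 (1966) 240, §II (ground-state energy is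
concave in the source; one-sided derivatives bracket the order parameter) [Griffiths1966].
-/

noncomputable section

open Complex Finset
open scoped InnerProductSpace ComplexConjugate

namespace Literature.MathematicalPhysics.QuantumLattice.GappedParamagnetExact

open Literature.Barriers.HubbardSuperconductivity.VanishingFieldSpins
open Literature.Barriers.HubbardSuperconductivity.GappedParamagnet
open Literature.MathematicalPhysics.QuantumLattice.KomaTasaki

variable {N : ℕ}

/-! ### §1  The on-site operator `k_x = B S^z_x − h S^x_x` and the sharp lower bound `K_h ≥ −(N/2)√(B²+h²)` -/

/-- The on-site term of the sourced paramagnet, `k_x = B S^z_x − h S^x_x`. [folklore] -/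
def siteOp (x : Fin N) (B h : ℝ) : Spins N →L[ℂ] Spins N :=
  diagOp x (fun b => (B : ℂ) * szSym b) - (h : ℂ) • flipOp x sxCoef

/-- `K_h = Σ_x k_x`. [folklore] -/
private theorem sourced_eq_sum_siteOp (B h : ℝ) : sourced N B h = ∑ x, siteOp x B h := by
  show (paramagnet N B).hamiltonian - (h : ℂ) • (paramagnet N B).order 0 = _
  rw [show (paramagnet N B).hamiltonian = ∑ x, diagOp x (fun b => (B : ℂ) * szSym b) from rfl,
    show (paramagnet N B).order 0 = ∑ x, flipOp x sxCoef from rfl, Finset.smul_sum,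
    ← Finset.sum_sub_distrib]
  rfl

/-- `k_x` in coordinates: `(k_x ψ)(σ) = B·szSym(σ_x)·ψ(σ) − (h/2)·ψ(flip_x σ)`. [folklore] -/
private theorem siteOp_apply (x : Fin N) (B h : ℝ) (ψ : Spins N) (σ : Cfg N) :
    siteOp x B h ψ σ = (B : ℂ) * szSym (σ x) * ψ σ - (h : ℂ) * (1 / 2) * ψ (flipAt x σ) := by
  simp only [siteOp, sub_apply, smul_apply, PiLp.sub_apply, PiLp.smul_apply, diagOp_apply, flipOp_apply,
    sxCoef, smul_eq_mul]
  ring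

/-- **`k_x² = ¼(B² + h²)`** (spin `½`: `(S^z)² = (S^x)² = ¼`, `S^zS^x + S^xS^z = 0`; i.e. `(2 n·S)² = |n|²` for a
single spin `½` in the field `n = (−h, 0, B)`). [cite: Tasaki2020, §2.1] -/
theorem siteOp_siteOp_apply (x : Fin N) (B h : ℝ) (ψ : Spins N) :
    siteOp x B h (siteOp x B h ψ) = ((((B ^ 2 + h ^ 2) / 4 : ℝ)) : ℂ) • ψ := by
  ext σ
  rw [PiLp.smul_apply, smul_eq_mul, siteOp_apply, siteOp_apply, siteOp_apply, flipAt_flipAt,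
    flipAt_apply_same]
  cases σ x
  · simp only [szSym, Bool.not_false, if_true, if_false, Bool.false_eq_true]
    push_cast
    ring
  · simp only [szSym, Bool.not_true, if_true, if_false, Bool.false_eq_true]
    push_cast
    ring

/-- `k_x` is symmetric. [folklore] -/
private theorem isSymmetric_siteOp (x : Fin N) (B h : ℝ) :
    ((siteOp x B h : Spins N →L[ℂ] Spins N) : Spins N →ₗ[ℂ] Spins N).IsSymmetric := by
  intro φ ψ
  have h1 := isSymmetric_diagOp x (s := fun b => (B : ℂ) * szSym b)
    (fun b => by rw [map_mul, conj_szSym, Complex.conj_ofReal]) φ ψ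
  have h2 := isSymmetric_flipOp x conj_sxCoef φ ψ
  simp only [ContinuousLinearMap.coe_coe] at h1 h2 ⊢
  simp only [siteOp, sub_apply, smul_apply, inner_sub_left, inner_sub_right, inner_smul_left,
    inner_smul_right, Complex.conj_ofReal, h1, h2]

/-- `Re⟨ψ, ψ⟩ = ‖ψ‖²`. [folklore] -/
private theorem re_inner_self' (ψ : Spins N) : (⟪ψ, ψ⟫_ℂ).re = ‖ψ‖ ^ 2 := by
  have := inner_self_eq_norm_sq (𝕜 := ℂ) ψ
  rwa [RCLike.re_to_complex] at this

/-- `‖k_x ψ‖² = ¼(B² + h²)‖ψ‖²`. [folklore] -/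
private theorem norm_sq_siteOp_apply (x : Fin N) (B h : ℝ) (ψ : Spins N) :
    ‖siteOp x B h ψ‖ ^ 2 = (B ^ 2 + h ^ 2) / 4 * ‖ψ‖ ^ 2 := by
  have h2 : ⟪siteOp x B h ψ, siteOp x B h ψ⟫_ℂ = ⟪ψ, siteOp x B h (siteOp x B h ψ)⟫_ℂ := by
    have := isSymmetric_siteOp x B h ψ (siteOp x B h ψ)
    simpa only [ContinuousLinearMap.coe_coe] using this
  rw [← re_inner_self', h2, siteOp_siteOp_apply, inner_smul_right, Complex.re_ofReal_mul, re_inner_self']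

/-- **Sharp on-site bound** `Re⟨ψ, k_x ψ⟩ ≥ −½√(B² + h²)‖ψ‖²` (Cauchy–Schwarz with `‖k_xψ‖ = ½√(B²+h²)‖ψ‖`).
[folklore] -/
private theorem re_inner_siteOp_ge (x : Fin N) (B h : ℝ) (ψ : Spins N) :
    -(Real.sqrt (B ^ 2 + h ^ 2) / 2) * ‖ψ‖ ^ 2 ≤ (⟪ψ, siteOp x B h ψ⟫_ℂ).re := by
  set ρ := Real.sqrt (B ^ 2 + h ^ 2) with hρdef
  have hρ : 0 ≤ ρ := Real.sqrt_nonneg _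
  have hρ2 : ρ ^ 2 = B ^ 2 + h ^ 2 := Real.sq_sqrt (by positivity)
  have hcs : ‖⟪ψ, siteOp x B h ψ⟫_ℂ‖ ≤ ‖ψ‖ * ‖siteOp x B h ψ‖ := norm_inner_le_norm _ _
  have hre : |(⟪ψ, siteOp x B h ψ⟫_ℂ).re| ≤ ‖⟪ψ, siteOp x B h ψ⟫_ℂ‖ := Complex.abs_re_le_norm _
  have hP : (‖ψ‖ * ‖siteOp x B h ψ‖) ^ 2 = (ρ / 2 * ‖ψ‖ ^ 2) ^ 2 := by
    rw [mul_pow, norm_sq_siteOp_apply, ← hρ2]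
    ring
  have hPle : ‖ψ‖ * ‖siteOp x B h ψ‖ ≤ ρ / 2 * ‖ψ‖ ^ 2 := by
    have h0 : 0 ≤ ‖ψ‖ * ‖siteOp x B h ψ‖ := by positivity
    have h0' : 0 ≤ ρ / 2 * ‖ψ‖ ^ 2 := by positivity
    nlinarith [hP, h0, h0']
  have := (abs_le.1 (hre.trans (hcs.trans hPle))).1
  linarith

/-- **The sharp lower bound on the sourced paramagnet:** `Re⟨ψ, K_h ψ⟩ ≥ −(N/2)√(B² + h²)·‖ψ‖²` for all real
`B, h` and every vector `ψ` (non-interacting spins `½` in the field `(−h, 0, B)`: each site contributes at least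
`−½|n|`). [cite: Tasaki2020, §2.1] -/
theorem re_inner_sourced_ge_sqrt (B h : ℝ) (ψ : Spins N) :
    -((N : ℝ) / 2 * Real.sqrt (B ^ 2 + h ^ 2)) * ‖ψ‖ ^ 2 ≤ (⟪ψ, sourced N B h ψ⟫_ℂ).re := by
  rw [sourced_eq_sum_siteOp, _root_.sum_apply, inner_sum, Complex.re_sum]
  calc -((N : ℝ) / 2 * Real.sqrt (B ^ 2 + h ^ 2)) * ‖ψ‖ ^ 2
      = ∑ _x : Fin N, -(Real.sqrt (B ^ 2 + h ^ 2) / 2) * ‖ψ‖ ^ 2 := by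
        rw [Finset.sum_const, Finset.card_univ, Fintype.card_fin, nsmul_eq_mul]; ring
    _ ≤ ∑ x : Fin N, (⟪ψ, siteOp x B h ψ⟫_ℂ).re := Finset.sum_le_sum fun x _ => re_inner_siteOp_ge x B h ψ

/-! ### §2  Product states and the tilted product state saturating the bound -/

/-- Product (unentangled) vector with real one-site amplitudes `w`: `ψ_w(σ) = Π_x w(σ_x)`. [folklore] -/
def productVec (w : Bool → ℝ) : Spins N := (WithLp.equiv 2 _).symm fun σ => ((∏ x, w (σ x) : ℝ) : ℂ)

/-- Coordinates of a product vector. [folklore] -/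
@[simp] private theorem productVec_apply (w : Bool → ℝ) (σ : Cfg N) :
    (productVec w : Spins N) σ = ((∏ x, w (σ x) : ℝ) : ℂ) := by
  simp [productVec]

/-- Marked-site factorisation: `Σ_σ G(σ_x) Π_{y ≠ x} c(σ_y) = (Σ_b G b)·(Σ_b c b)^(N−1)`. [folklore] -/
private theorem sum_marked_prod {R : Type*} [CommRing R] (x : Fin N) (G c : Bool → R) :
    ∑ σ : Cfg N, G (σ x) * ∏ y ∈ ({x} : Finset (Fin N))ᶜ, c (σ y) = (∑ b, G b) * (∑ b, c b) ^ (N - 1) := by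
  classical
  set F : Fin N → Bool → R := Function.update (fun _ => c) x G with hF
  have hFx : F x = G := by simp [hF]
  have hFy : ∀ y, y ≠ x → F y = c := fun y hy => by simp [hF, hy]
  have hmem : ∀ y, y ∈ ({x} : Finset (Fin N))ᶜ → y ≠ x := fun y hy => by simpa using hy
  have hL : ∀ σ : Cfg N, ∏ y, F y (σ y) = G (σ x) * ∏ y ∈ ({x} : Finset (Fin N))ᶜ, c (σ y) := by
    intro σ
    rw [Fintype.prod_eq_mul_prod_compl x, hFx]
    congr 1
    exact Finset.prod_congr rfl fun y hy => by rw [hFy y (hmem y hy)]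
  have hR : ∏ y, ∑ b, F y b = (∑ b, G b) * (∑ b, c b) ^ (N - 1) := by
    rw [Fintype.prod_eq_mul_prod_compl x, hFx]
    congr 1
    rw [Finset.prod_congr rfl fun y hy => by rw [hFy y (hmem y hy)], Finset.prod_const, Finset.card_compl,
      Fintype.card_fin, Finset.card_singleton]
  calc ∑ σ : Cfg N, G (σ x) * ∏ y ∈ ({x} : Finset (Fin N))ᶜ, c (σ y)
      = ∑ σ : Cfg N, ∏ y, F y (σ y) := by simp only [hL]
    _ = ∏ y, ∑ b, F y b := (Fintype.prod_sum F).symm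
    _ = _ := hR

/-- `Π_y w(σ_y) = w(σ_x)·Π_{y ≠ x} w(σ_y)`. [folklore] -/
private theorem prod_cfg_eq {R : Type*} [CommMonoid R] (w : Bool → R) (x : Fin N) (σ : Cfg N) :
    ∏ y, w (σ y) = w (σ x) * ∏ y ∈ ({x} : Finset (Fin N))ᶜ, w (σ y) :=
  Fintype.prod_eq_mul_prod_compl x _

/-- `Π_y w((flip_x σ)_y) = w(!σ_x)·Π_{y ≠ x} w(σ_y)`. [folklore] -/
private theorem prod_cfg_flipAt {R : Type*} [CommMonoid R] (w : Bool → R) (x : Fin N) (σ : Cfg N) :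
    ∏ y, w (flipAt x σ y) = w (!σ x) * ∏ y ∈ ({x} : Finset (Fin N))ᶜ, w (σ y) := by
  rw [Fintype.prod_eq_mul_prod_compl x, flipAt_apply_same]
  congr 1
  exact Finset.prod_congr rfl fun y hy => by
    rw [flipAt_apply_of_ne (show y ≠ x by simpa using hy)]

/-- Squared norm of a product vector: `‖ψ_w‖² = (Σ_b w(b)²)^N`. [folklore] -/
private theorem norm_sq_productVec (w : Bool → ℝ) : ‖(productVec w : Spins N)‖ ^ 2 = (∑ b, w b ^ 2) ^ N := by
  rw [norm_sq_eq_sum]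
  simp only [productVec_apply, Complex.norm_real, Real.norm_eq_abs, sq_abs, ← Finset.prod_pow]
  calc ∑ σ : Cfg N, ∏ x, w (σ x) ^ 2 = ∏ _x : Fin N, ∑ b : Bool, w b ^ 2 :=
        (Fintype.prod_sum fun (_ : Fin N) (b : Bool) => w b ^ 2).symm
    _ = (∑ b, w b ^ 2) ^ N := by rw [Finset.prod_const, Finset.card_univ, Fintype.card_fin]

/-- One-site diagonal expectation in a product state:
`⟨ψ_w, diag_x(s) ψ_w⟩ = (Σ_b s(b) w(b)²)·(Σ_b w(b)²)^(N−1)` (real symbol `s`). [folklore] -/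
private theorem inner_productVec_diagOp (x : Fin N) (s w : Bool → ℝ) :
    ⟪(productVec w : Spins N), diagOp x (fun b => ((s b : ℝ) : ℂ)) (productVec w)⟫_ℂ =
      (((∑ b, s b * w b ^ 2) * (∑ b, w b ^ 2) ^ (N - 1) : ℝ) : ℂ) := by
  rw [inner_eq_sum]
  simp only [diagOp_apply, productVec_apply, Complex.conj_ofReal]
  have : ∀ σ : Cfg N, ((∏ y, w (σ y) : ℝ) : ℂ) * ((s (σ x) : ℂ) * ((∏ y, w (σ y) : ℝ) : ℂ)) =
      (((s (σ x) * w (σ x) ^ 2) * ∏ y ∈ ({x} : Finset (Fin N))ᶜ, w (σ y) ^ 2 : ℝ) : ℂ) := by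
    intro σ
    have hP : (∏ y ∈ ({x} : Finset (Fin N))ᶜ, w (σ y)) ^ 2 = ∏ y ∈ ({x} : Finset (Fin N))ᶜ, w (σ y) ^ 2 :=
      (Finset.prod_pow _ 2 _).symm
    rw [prod_cfg_eq w x σ, ← hP]
    push_cast
    ring
  simp only [this, ← Complex.ofReal_sum]
  rw [sum_marked_prod x (fun b => s b * w b ^ 2) (fun b => w b ^ 2)]

/-- One-site flip expectation in a product state:
`⟨ψ_w, flip_x(a) ψ_w⟩ = (Σ_b a(b) w(b) w(!b))·(Σ_b w(b)²)^(N−1)` (real coefficient `a`). [folklore] -/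
private theorem inner_productVec_flipOp (x : Fin N) (a w : Bool → ℝ) :
    ⟪(productVec w : Spins N), flipOp x (fun b => ((a b : ℝ) : ℂ)) (productVec w)⟫_ℂ =
      (((∑ b, a b * (w b * w (!b))) * (∑ b, w b ^ 2) ^ (N - 1) : ℝ) : ℂ) := by
  rw [inner_eq_sum]
  simp only [flipOp_apply, productVec_apply, Complex.conj_ofReal]
  have : ∀ σ : Cfg N, ((∏ y, w (σ y) : ℝ) : ℂ) * ((a (σ x) : ℂ) * ((∏ y, w (flipAt x σ y) : ℝ) : ℂ)) =
      (((a (σ x) * (w (σ x) * w (!σ x))) * ∏ y ∈ ({x} : Finset (Fin N))ᶜ, w (σ y) ^ 2 : ℝ) : ℂ) := by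
    intro σ
    have hP : (∏ y ∈ ({x} : Finset (Fin N))ᶜ, w (σ y)) ^ 2 = ∏ y ∈ ({x} : Finset (Fin N))ᶜ, w (σ y) ^ 2 :=
      (Finset.prod_pow _ 2 _).symm
    rw [prod_cfg_eq w x σ, prod_cfg_flipAt w x σ, ← hP]
    push_cast
    ring
  simp only [this, ← Complex.ofReal_sum]
  rw [sum_marked_prod x (fun b => a b * (w b * w (!b))) (fun b => w b ^ 2)]

/-- Real part of the sourced energy: `Re⟨ψ, K_h ψ⟩ = Re⟨ψ, Hψ⟩ − h·Re⟨ψ, Oψ⟩`. [folklore] -/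
private theorem re_inner_sourced' (B h : ℝ) (ψ : Spins N) :
    (⟪ψ, sourced N B h ψ⟫_ℂ).re =
      (⟪ψ, (paramagnet N B).hamiltonian ψ⟫_ℂ).re - h * (⟪ψ, (paramagnet N B).order 0 ψ⟫_ℂ).re := by
  simp only [sourced, FunLike.coe_sub, FunLike.coe_smul, Pi.sub_apply, Pi.smul_apply, inner_sub_right,
    inner_smul_right, Complex.sub_re, Complex.re_ofReal_mul]

/-- Two sources compose in expectation: `Re⟨ψ, K_{h+s} ψ⟩ = Re⟨ψ, K_hψ⟩ − s·Re⟨ψ, Oψ⟩`. [folklore] -/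
private theorem re_inner_sourced_add' (B h s : ℝ) (ψ : Spins N) :
    (⟪ψ, sourced N B (h + s) ψ⟫_ℂ).re =
      (⟪ψ, sourced N B h ψ⟫_ℂ).re - s * (⟪ψ, (paramagnet N B).order 0 ψ⟫_ℂ).re := by
  rw [re_inner_sourced', re_inner_sourced']
  ring

/-- The amplitudes of the tilted product state: `w(↑) = h`, `w(↓) = √(B² + h²) + B`. [folklore] -/
def tiltAmp (B h : ℝ) : Bool → ℝ := fun b => if b then h else Real.sqrt (B ^ 2 + h ^ 2) + B

/-- **The tilted product state** `⊗_x ((√(B²+h²) + B)|↓⟩_x + h|↑⟩_x)` — the exact (un-normalised) ground state of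
`K_h`: every spin along the field `(−h, 0, B)·(−1)` direction in the `xz`-plane. [folklore] -/
def tilt (B h : ℝ) : Spins N := productVec (tiltAmp B h)

/-- `Σ_b w(b)² = 2√(B²+h²)(√(B²+h²) + B)` for the tilt amplitudes. [folklore] -/
private theorem sum_tiltAmp_sq (B h : ℝ) :
    ∑ b, tiltAmp B h b ^ 2 = 2 * Real.sqrt (B ^ 2 + h ^ 2) * (Real.sqrt (B ^ 2 + h ^ 2) + B) := by
  have hρ2 : Real.sqrt (B ^ 2 + h ^ 2) ^ 2 = B ^ 2 + h ^ 2 := Real.sq_sqrt (by positivity)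
  rw [Fintype.sum_bool]
  simp only [tiltAmp, if_true, Bool.false_eq_true, if_false]
  nlinarith [hρ2]

/-- The symmetric energy of the tilted state: `Re⟨ψ, Hψ⟩ = N·(B/2)(h² − (√(B²+h²)+B)²)·S^(N−1)`,
`S = Σ_b w(b)²`. [folklore] -/
private theorem re_inner_hamiltonian_tilt (B h : ℝ) :
    (⟪(tilt B h : Spins N), (paramagnet N B).hamiltonian (tilt B h)⟫_ℂ).re =
      N * ((B / 2 * (h ^ 2 - (Real.sqrt (B ^ 2 + h ^ 2) + B) ^ 2)) *
        (∑ b, tiltAmp B h b ^ 2) ^ (N - 1)) := by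
  have hsym : (fun b => (B : ℂ) * szSym b) = fun b => (((B * szR b : ℝ)) : ℂ) := by
    funext b
    cases b <;> simp [szSym, szR]
  rw [show (paramagnet N B).hamiltonian = ∑ x, diagOp x (fun b => (B : ℂ) * szSym b) from rfl, hsym,
    _root_.sum_apply, inner_sum, Complex.re_sum]
  simp only [tilt, inner_productVec_diagOp, Complex.ofReal_re]
  rw [Finset.sum_const, Finset.card_univ, Fintype.card_fin, nsmul_eq_mul]
  congr 1
  rw [Fintype.sum_bool]
  simp only [tiltAmp, szR, if_true, Bool.false_eq_true, if_false]
  ring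

/-- The order-parameter expectation of the tilted state: `Re⟨ψ, Oψ⟩ = N·h(√(B²+h²)+B)·S^(N−1)`. [folklore] -/
private theorem re_inner_order_zero_tilt (B h : ℝ) :
    (⟪(tilt B h : Spins N), (paramagnet N B).order 0 (tilt B h)⟫_ℂ).re =
      N * ((h * (Real.sqrt (B ^ 2 + h ^ 2) + B)) * (∑ b, tiltAmp B h b ^ 2) ^ (N - 1)) := by
  have hsym : (sxCoef : Bool → ℂ) = fun b => ((((fun _ => (1 / 2 : ℝ)) b : ℝ)) : ℂ) := by
    funext b
    simp [sxCoef]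
  rw [show (paramagnet N B).order 0 = ∑ x, flipOp x sxCoef from rfl, hsym, _root_.sum_apply, inner_sum,
    Complex.re_sum]
  simp only [tilt, inner_productVec_flipOp, Complex.ofReal_re]
  rw [Finset.sum_const, Finset.card_univ, Fintype.card_fin, nsmul_eq_mul]
  congr 1
  rw [Fintype.sum_bool]
  simp only [tiltAmp, if_true, Bool.false_eq_true, if_false, Bool.not_true, Bool.not_false]
  ring

/-- **The tilted product state saturates the sharp bound:** `Re⟨ψ, K_h ψ⟩ = −(N/2)√(B²+h²)·‖ψ‖²` (all spins
along the field). [cite: Tasaki2020, §2.1] -/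
theorem re_inner_sourced_tilt (B h : ℝ) :
    (⟪(tilt B h : Spins N), sourced N B h (tilt B h)⟫_ℂ).re =
      -((N : ℝ) / 2 * Real.sqrt (B ^ 2 + h ^ 2)) * ‖(tilt B h : Spins N)‖ ^ 2 := by
  rw [re_inner_sourced', re_inner_hamiltonian_tilt, re_inner_order_zero_tilt, tilt, norm_sq_productVec]
  set ρ := Real.sqrt (B ^ 2 + h ^ 2) with hρdef
  have hρ2 : ρ ^ 2 = B ^ 2 + h ^ 2 := Real.sq_sqrt (by positivity)
  set S := ∑ b, tiltAmp B h b ^ 2 with hSdef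
  have hS : S = 2 * ρ * (ρ + B) := sum_tiltAmp_sq B h
  -- per site: `(B/2)(h² − (ρ+B)²) − h·h(ρ+B) = −(ρ/2)·S`
  have key : B / 2 * (h ^ 2 - (ρ + B) ^ 2) - h * (h * (ρ + B)) = -(ρ / 2) * S := by
    rw [hS]; linear_combination (B / 2 + ρ) * hρ2
  -- `S^N = S · S^(N-1)` (for `N = 0` both sides vanish)
  rcases Nat.eq_zero_or_pos N with hN | hN
  · subst hN; simp
  · obtain ⟨n, rfl⟩ : ∃ n, N = n + 1 := ⟨N - 1, by omega⟩
    rw [Nat.add_sub_cancel, pow_succ S n]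
    push_cast
    linear_combination ((n : ℝ) + 1) * S ^ n * key

/-- The tilted state is nonzero for `B > 0` (its `|⇓⟩` amplitude is `(√(B²+h²) + B)^N > 0`). [folklore] -/
private theorem norm_tilt_pos {B : ℝ} (hB : 0 < B) (h : ℝ) : 0 < ‖(tilt B h : Spins N)‖ := by
  have hρ : 0 ≤ Real.sqrt (B ^ 2 + h ^ 2) := Real.sqrt_nonneg _
  have h2 : 0 < ‖(tilt B h : Spins N)‖ ^ 2 := by
    rw [tilt, norm_sq_productVec, sum_tiltAmp_sq]
    have : 0 < 2 * Real.sqrt (B ^ 2 + h ^ 2) * (Real.sqrt (B ^ 2 + h ^ 2) + B) := by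
      have hρB : B ≤ Real.sqrt (B ^ 2 + h ^ 2) := (Real.le_sqrt hB.le (by positivity)).2 (by nlinarith)
      nlinarith
    positivity
  have h0 : ‖(tilt B h : Spins N)‖ ≠ 0 := fun h0 => by rw [h0] at h2; simp at h2
  exact lt_of_le_of_ne (norm_nonneg _) (Ne.symm h0)

/-! ### §3  Exact ground energy and exact response of every variational ground state -/

/-- Minimality against all vectors: a variational ground state `Φ` of `K` gives `Re⟨Φ, KΦ⟩·‖ψ‖² ≤ Re⟨ψ, Kψ⟩`.
[folklore] -/
private theorem energy_mul_norm_sq_le {K : Spins N →L[ℂ] Spins N} {Φ : Spins N}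
    (hΦ : IsVariationalGS K Φ) (ψ : Spins N) :
    (⟪Φ, K Φ⟫_ℂ).re * ‖ψ‖ ^ 2 ≤ (⟪ψ, K ψ⟫_ℂ).re := by
  by_cases hψ : ψ = 0
  · simp [hψ]
  · have hnpos : 0 < ‖ψ‖ := norm_pos_iff.2 hψ
    set c : ℝ := ‖ψ‖⁻¹ with hc
    have hcpos : 0 < c := inv_pos.2 hnpos
    have hunit : ‖((c : ℂ) • ψ)‖ = 1 := by
      rw [norm_smul, Complex.norm_real, Real.norm_eq_abs, abs_of_pos hcpos, hc]
      exact inv_mul_cancel₀ hnpos.ne'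
    have h1 := hΦ.2 _ hunit
    rw [map_smul, inner_smul_left, inner_smul_right, Complex.conj_ofReal, ← mul_assoc, ← Complex.ofReal_mul,
      Complex.re_ofReal_mul] at h1
    have hcc : c * c * ‖ψ‖ ^ 2 = 1 := by rw [hc]; field_simp
    calc (⟪Φ, K Φ⟫_ℂ).re * ‖ψ‖ ^ 2 ≤ c * c * (⟪ψ, K ψ⟫_ℂ).re * ‖ψ‖ ^ 2 :=
          mul_le_mul_of_nonneg_right h1 (sq_nonneg _)
      _ = (⟪ψ, K ψ⟫_ℂ).re * (c * c * ‖ψ‖ ^ 2) := by ring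
      _ = (⟪ψ, K ψ⟫_ℂ).re := by rw [hcc, mul_one]

/-- **Exact sourced ground energy.** For `B > 0` and every field `h`, every variational ground state `Φ` of
`K_h = H − hO` on `N` sites has `Re⟨Φ, K_hΦ⟩ = −(N/2)√(B² + h²)` (ground energy of `N` non-interacting spins `½` in a
field of strength `√(B² + h²)`). [cite: Tasaki2020, §2.1] -/
theorem gs_energy_eq {B : ℝ} (hB : 0 < B) (h : ℝ) {Φ : Spins N} (hΦ : IsVariationalGS (sourced N B h) Φ) :
    (⟪Φ, sourced N B h Φ⟫_ℂ).re = -((N : ℝ) / 2 * Real.sqrt (B ^ 2 + h ^ 2)) := by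
  apply le_antisymm
  · have h1 := energy_mul_norm_sq_le hΦ (tilt B h)
    rw [re_inner_sourced_tilt] at h1
    have hpos : 0 < ‖(tilt B h : Spins N)‖ ^ 2 := pow_pos (norm_tilt_pos hB h) 2
    exact le_of_mul_le_mul_right h1 hpos
  · have := re_inner_sourced_ge_sqrt B h Φ
    rw [hΦ.1, one_pow, mul_one] at this
    exact this

/-- **Exact response (Hellmann–Feynman by Fermat's theorem).** For `B > 0` and every field `h`, every
variational ground state `Φ` of `K_h` has `Re⟨Φ, OΦ⟩ = N·h/(2√(B² + h²))`: the function
`h' ↦ (N/2)√(B² + h'²) − (h' − h)·Re⟨Φ, OΦ⟩` is minimal at `h' = h` (variational principle at every field against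
the exact energies), hence has zero derivative there (Griffiths' ground-state-energy convexity argument, sharp case).
[cite: Griffiths1966, §II] -/
theorem gs_response_eq {B : ℝ} (hB : 0 < B) (h : ℝ) {Φ : Spins N} (hΦ : IsVariationalGS (sourced N B h) Φ) :
    (⟪Φ, (paramagnet N B).order 0 Φ⟫_ℂ).re = (N : ℝ) * h / (2 * Real.sqrt (B ^ 2 + h ^ 2)) := by
  set X := (⟪Φ, (paramagnet N B).order 0 Φ⟫_ℂ).re with hX
  set g : ℝ → ℝ := fun h' => (N : ℝ) / 2 * Real.sqrt (B ^ 2 + h' ^ 2) - (h' - h) * X with hg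
  -- variational inequality at every field `h'`
  have hvar : ∀ h' : ℝ, g h ≤ g h' := by
    intro h'
    have h1 := re_inner_sourced_ge_sqrt B h' Φ
    rw [hΦ.1, one_pow, mul_one] at h1
    have h2 : (⟪Φ, sourced N B h' Φ⟫_ℂ).re = (⟪Φ, sourced N B h Φ⟫_ℂ).re - (h' - h) * X := by
      have := re_inner_sourced_add' B h (h' - h) Φ
      rwa [add_sub_cancel] at this
    rw [h2, gs_energy_eq hB h hΦ] at h1
    simp only [hg, sub_self, zero_mul, sub_zero]
    linarith
  have hmin : IsLocalMin g h := Filter.Eventually.of_forall hvar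
  have hρpos : 0 < Real.sqrt (B ^ 2 + h ^ 2) := Real.sqrt_pos.2 (by positivity)
  have hderiv : HasDerivAt g ((N : ℝ) / 2 * (2 * h / (2 * Real.sqrt (B ^ 2 + h ^ 2))) - 1 * X) h := by
    have hd1 : HasDerivAt (fun h' : ℝ => B ^ 2 + h' ^ 2) (2 * h) h := by
      have := (hasDerivAt_pow 2 h).const_add (B ^ 2)
      simpa using this
    have hd2 : HasDerivAt (fun h' : ℝ => Real.sqrt (B ^ 2 + h' ^ 2)) (2 * h / (2 * Real.sqrt (B ^ 2 + h ^ 2))) h :=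
      hd1.sqrt (by positivity)
    have hd2' : HasDerivAt (fun h' : ℝ => (N : ℝ) / 2 * Real.sqrt (B ^ 2 + h' ^ 2))
        ((N : ℝ) / 2 * (2 * h / (2 * Real.sqrt (B ^ 2 + h ^ 2)))) h :=
      HasDerivAt.const_mul ((N : ℝ) / 2) hd2
    have hd3 : HasDerivAt (fun h' : ℝ => (h' - h) * X) (1 * X) h :=
      ((hasDerivAt_id' h).sub_const h).mul_const X
    exact hd2'.sub hd3
  have hzero := hmin.hasDerivAt_eq_zero hderiv
  have : X = (N : ℝ) / 2 * (2 * h / (2 * Real.sqrt (B ^ 2 + h ^ 2))) := by linarith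
  rw [this]
  field_simp

/-! ### §4  The closed forms as functions of the field (no volume dependence) and `m* = 0` -/

/-- **Sourced ground-energy density** of the paramagnet, `e(B, h) = −½√(B² + h²)` (exact at every volume,
`gs_energy_eq`). [folklore] -/
def energyDensity (B h : ℝ) : ℝ := -(Real.sqrt (B ^ 2 + h ^ 2) / 2)

/-- **Response** (sourced one-point order parameter per site, Koma–Tasaki's `m(h)` before `h ↓ 0`),
`m(B, h) = h/(2√(B² + h²))` (exact at every volume, `gs_response_eq`; Koma–Tasaki's transverse-field example in its
paramagnetic regime, here at zero exchange). [cite: KomaTasaki1994, §1.2] -/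
def response (B h : ℝ) : ℝ := h / (2 * Real.sqrt (B ^ 2 + h ^ 2))

/-- **Energy chord** `S(a, b) = (e(a) − e(b))/(b − a)` — the certified object of the cell's PC-a line
(`S(a,b) ∈ [m(a), m(b)]` by concavity — Griffiths' argument). [cite: Griffiths1966, §II] -/
def chord (B a b : ℝ) : ℝ := (energyDensity B a - energyDensity B b) / (b - a)

/-- Model link, energy: every variational ground state of `K_h` on `N` sites has energy `N·e(B, h)`.
[cite: Tasaki2020, §2.1] -/
theorem gs_energy_eq_mul_energyDensity {B : ℝ} (hB : 0 < B) (h : ℝ) {Φ : Spins N}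
    (hΦ : IsVariationalGS (sourced N B h) Φ) : (⟪Φ, sourced N B h Φ⟫_ℂ).re = N * energyDensity B h := by
  rw [gs_energy_eq hB h hΦ, energyDensity]; ring

/-- Model link, response: every variational ground state of `K_h` on `N` sites has `Re⟨Φ, OΦ⟩ = N·m(B, h)`.
[cite: KomaTasaki1994, §1.2] -/
theorem gs_response_eq_mul_response {B : ℝ} (hB : 0 < B) (h : ℝ) {Φ : Spins N}
    (hΦ : IsVariationalGS (sourced N B h) Φ) :
    (⟪Φ, (paramagnet N B).order 0 Φ⟫_ℂ).re = N * response B h := by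
  rw [gs_response_eq hB h hΦ, response]; ring

/-- `0 ≤ m(B, h)` for `h ≥ 0`. [cite: KomaTasaki1994, §1.2] -/
theorem response_nonneg (B : ℝ) {h : ℝ} (hh : 0 ≤ h) : 0 ≤ response B h := by
  unfold response; positivity

/-- `m(B, h) < ½ = ō` (never saturated) for `B > 0`. [cite: KomaTasaki1994, §1.2] -/
theorem response_lt_half {B : ℝ} (hB : 0 < B) (h : ℝ) : response B h < 1 / 2 := by
  unfold response
  have hρ : 0 < Real.sqrt (B ^ 2 + h ^ 2) := Real.sqrt_pos.2 (by positivity)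
  have hlt : h < Real.sqrt (B ^ 2 + h ^ 2) := by
    rcases le_or_gt h 0 with hh | hh
    · linarith
    · exact (Real.lt_sqrt hh.le).2 (by nlinarith)
  rw [div_lt_iff₀ (by positivity)]
  linarith

/-- **`m* = 0`, quantitative:** `m(B, h) ≤ h/(2B)` for `B > 0`, `h ≥ 0` (linear response of a gapped phase; the
`m(B) = 0` regime of Koma–Tasaki's example). [cite: KomaTasaki1994, §1.2] -/
theorem response_le {B : ℝ} (hB : 0 < B) {h : ℝ} (hh : 0 ≤ h) : response B h ≤ h / (2 * B) := by
  unfold response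
  have hρB : B ≤ Real.sqrt (B ^ 2 + h ^ 2) := (Real.le_sqrt hB.le (by positivity)).2 (by nlinarith)
  exact div_le_div_of_nonneg_left hh (by positivity) (by linarith)

/-- **`m* = 0` as a limit:** `m(B, h) → 0` as `h → 0` (`B ≠ 0`; in particular the Koma–Tasaki order parameter
`lim_{h↓0} lim_N m_N(h)` of the paramagnet vanishes, the `N`-limit being an identity). [cite: KomaTasaki1994, §1.2] -/
theorem tendsto_response_zero {B : ℝ} (hB : B ≠ 0) :
    Filter.Tendsto (response B) (nhds 0) (nhds 0) := by
  have hc : Continuous (response B) := by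
    unfold response
    refine Continuous.div continuous_id (by fun_prop) fun h => ?_
    have : 0 < Real.sqrt (B ^ 2 + h ^ 2) := Real.sqrt_pos.2 (by positivity)
    positivity
  have := hc.tendsto 0
  simpa [response] using this

/-- The response floor of `FiniteFieldResponseWithoutLRO` in closed form: `m(B, a) ≥ ½(1 − B/a)` for `a > 0` (since
`√(B²+a²) ≤ B + a`; cf. `GappedParamagnet.response_floor`). [cite: KomaTasaki1994, §1.2] -/
theorem response_ge {B : ℝ} (hB : 0 ≤ B) {a : ℝ} (ha : 0 < a) : 1 / 2 * (1 - B / a) ≤ response B a := by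
  unfold response
  have hρ : Real.sqrt (B ^ 2 + a ^ 2) ≤ B + a := (Real.sqrt_le_left (by linarith)).2 (by nlinarith)
  have hρpos : 0 < Real.sqrt (B ^ 2 + a ^ 2) := Real.sqrt_pos.2 (by positivity)
  rw [show 1 / 2 * (1 - B / a) = (a - B) / (2 * a) by field_simp]
  rw [div_le_div_iff₀ (by positivity) (by positivity)]
  nlinarith

/-! ### §5  Chord sandwich `m(a) ≤ S(a, b) ≤ m(b)` (the certified bracket of the PC-a line, here exact) -/

/-- Closed form of the chord: `S(a, b) = (a + b)/(2(√(B²+a²) + √(B²+b²)))` for `a ≠ b`. [cite: Griffiths1966, §II] -/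
theorem chord_eq (B : ℝ) {a b : ℝ} (hab : a ≠ b) :
    chord B a b = (a + b) / (2 * (Real.sqrt (B ^ 2 + a ^ 2) + Real.sqrt (B ^ 2 + b ^ 2))) := by
  unfold chord energyDensity
  set ra := Real.sqrt (B ^ 2 + a ^ 2) with hra
  set rb := Real.sqrt (B ^ 2 + b ^ 2) with hrb
  have hra2 : ra ^ 2 = B ^ 2 + a ^ 2 := Real.sq_sqrt (by positivity)
  have hrb2 : rb ^ 2 = B ^ 2 + b ^ 2 := Real.sq_sqrt (by positivity)
  have hra0 : 0 ≤ ra := Real.sqrt_nonneg _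
  have hrb0 : 0 ≤ rb := Real.sqrt_nonneg _
  have hsum : 0 < ra + rb := by
    rcases eq_or_ne a 0 with ha | ha
    · have hb : b ≠ 0 := fun hb => hab (by rw [ha, hb])
      have : 0 < rb := Real.sqrt_pos.2 (by positivity)
      linarith
    · have : 0 < ra := Real.sqrt_pos.2 (by positivity)
      linarith
  have hba : b - a ≠ 0 := sub_ne_zero.2 (Ne.symm hab)
  rw [div_eq_div_iff hba (by positivity)]
  -- `(rb - ra)(ra + rb) = b² - a²`
  have key : (rb - ra) * (ra + rb) = (b - a) * (a + b) := by nlinarith [hra2, hrb2]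
  nlinarith [key]

/-- **Lower chord bound** `m(a) ≤ S(a, b)` for `0 ≤ a < b` (concavity of `e` in the source — Griffiths' argument;
here by the closed form). [cite: Griffiths1966, §II] -/
theorem response_le_chord (B : ℝ) {a b : ℝ} (ha : 0 ≤ a) (hab : a < b) : response B a ≤ chord B a b := by
  rw [chord_eq B hab.ne, response]
  set ra := Real.sqrt (B ^ 2 + a ^ 2) with hra
  set rb := Real.sqrt (B ^ 2 + b ^ 2) with hrb
  have hra2 : ra ^ 2 = B ^ 2 + a ^ 2 := Real.sq_sqrt (by positivity)
  have hrb2 : rb ^ 2 = B ^ 2 + b ^ 2 := Real.sq_sqrt (by positivity)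
  have hrb0 : 0 < rb := Real.sqrt_pos.2 (by nlinarith)
  have hra0 : 0 ≤ ra := Real.sqrt_nonneg _
  rcases ha.eq_or_lt with rfl | ha'
  · simp only [zero_div, zero_add]; positivity
  have hra0' : 0 < ra := Real.sqrt_pos.2 (by positivity)
  rw [div_le_div_iff₀ (by positivity) (by positivity)]
  -- `a (ra + rb) ≤ (a + b) ra  ⟸  a rb ≤ b ra  ⟸  a² rb² ≤ b² ra²`
  have h1 : a * rb ≤ b * ra := by
    have : (a * rb) ^ 2 ≤ (b * ra) ^ 2 := by
      have hx : 0 ≤ (b ^ 2 - a ^ 2) * B ^ 2 := mul_nonneg (by nlinarith) (sq_nonneg B)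
      rw [mul_pow, mul_pow, hra2, hrb2]; nlinarith [hx]
    exact (pow_le_pow_iff_left₀ (by positivity) (mul_nonneg (by linarith) hra0) two_ne_zero).1 this
  nlinarith [h1]

/-- **Upper chord bound** `S(a, b) ≤ m(b)` for `0 ≤ a < b` (Griffiths' argument; closed form). [cite: Griffiths1966, §II] -/
theorem chord_le_response (B : ℝ) {a b : ℝ} (ha : 0 ≤ a) (hab : a < b) : chord B a b ≤ response B b := by
  rw [chord_eq B hab.ne, response]
  set ra := Real.sqrt (B ^ 2 + a ^ 2) with hra
  set rb := Real.sqrt (B ^ 2 + b ^ 2) with hrb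
  have hra2 : ra ^ 2 = B ^ 2 + a ^ 2 := Real.sq_sqrt (by positivity)
  have hrb2 : rb ^ 2 = B ^ 2 + b ^ 2 := Real.sq_sqrt (by positivity)
  have hrb0 : 0 < rb := Real.sqrt_pos.2 (by nlinarith)
  have hra0 : 0 ≤ ra := Real.sqrt_nonneg _
  rw [div_le_div_iff₀ (by positivity) (by positivity)]
  have h1 : a * rb ≤ b * ra := by
    have : (a * rb) ^ 2 ≤ (b * ra) ^ 2 := by
      have hx : 0 ≤ (b ^ 2 - a ^ 2) * B ^ 2 := mul_nonneg (by nlinarith) (sq_nonneg B)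
      rw [mul_pow, mul_pow, hra2, hrb2]; nlinarith [hx]
    exact (pow_le_pow_iff_left₀ (by positivity) (mul_nonneg (by linarith) hra0) two_ne_zero).1 this
  nlinarith [h1]

end Literature.MathematicalPhysics.QuantumLattice.GappedParamagnetExact
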